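import Mathlib
import Summits.KontsevichZagierPeriods.Zeta5Search.WedgeDictionaryTerminalDescent
import Summits.KontsevichZagierPeriods.Zeta5Search.Elimination.PencilBridge
import HarnessLib

/-!
HONEST FRAMING: systematic search; no irrationality claim unless certified — identities and finite bookkeeping only.

# The descent without the global `DictPencil`: the interior pencil theorem suffices up to the stratum `c_i = 0`

fam-elim (class `elim`), gen 24, E-L23.  gen-1's descent `WedgeDictionary.explicitPQ_of_terminal`
(`WedgeDictionaryTerminalDescent`) reduces `explicitPQ` to the terminal region points under the four relation families
`CellStar`, `DictStar`, `CellPencil`, `DictPencil`; its PENCIL step at a region point `a` with all slots `≥ 1` consumes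
`DictPencil` at the base `a − DS` and the slot `1`.  E-L19 (`Elimination/PencilBridge.dictPencil_at`, tree) PROVES the
dictionary pencil relation on the interior `c_i ≥ 1`, `c_i + 1 ≤ c₀`, non-edge pairs `∌ i` of sum `≤ c₀`.  THIS FILE
re-routes the pencil step to a slot chosen from the point:
* if some slot of `a` equals `1`, pencil at that slot `m`: the base has `c_m = 0` — the ONLY place where a dictionary
  pencil hypothesis is still consumed, recorded as the thin node `DictPencilZero` (= `DictPencil` restricted to `c_i = 0`);
* otherwise (all slots `≥ 2`) pencil at a slot `i` of MAXIMAL value: then `c_i ≥ 1`, `c_i + 1 ≤ c₀` and every non-edge pair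
  avoiding `i` has sum `≤ c₀` (`exists_interior_slot`: two slots at the top value `(N+1)/2` form a non-edge pair, and the
  non-edge graph `{16,17,27,35,45,46}` has no triangle), so the tree's `dictPencil_at` supplies the relation.
Result: **`explicitPQ_of_terminal_zero`** — gen-1's descent theorem with the hypothesis `DictPencil` replaced by
`DictPencilZero` (the other three families and the terminal interface unchanged).  Census (memo
`pub-zeta5-fam-elim/g24/BOUNDARY.md` §8): of the 79 040 pencil steps at level `≤ 9` the interior theorem serves all but the
`c_i = 0` ones; the STAR family is only ever consumed at points with a zero slot.
What this is NOT: anything about sizes, denominators or irrationality; `DictStar`, `CellStar`, `CellPencil`,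
`DictPencilZero` remain hypotheses; the class verdict is unchanged (T1 NO / T2 NO / T4 YES).
-/

open Finset

namespace Summit.KontsevichZagierPeriods.Zeta5Search.Elimination

open Summit.KontsevichZagierPeriods.Zeta5Search.WedgeDictionary
open Literature.NumberTheory.Irrationality.BrownZudilin2022 (bOfA Converges convergenceForms)

/-! ## 1. The residual node -/

/-- **PENCIL, dictionary side, on the stratum `c_i = 0` (INTERNALLY MINTED; conjecture)** — gen-1's
`WedgeDictionaryThreeTerm.DictPencil` restricted to the bases `c = b(a)` with `c_i = 0` (the axis `(M;0⁷)` included).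
Evidence: it is an instance family of `DictPencil` (verified exactly at 316 instances incl. 308 boundary points by gen-1);
the interior `c_i ≥ 1` is the theorem `dictPencil_at`. -/
@[conjecture] def DictPencilZero : Prop :=
  ∀ (a : Fin 8 → ℤ) (i j₀ j₁ j₂ : ℕ), i ∈ Icc 1 7 → bOfA a i = 0 →
    RegionHyp a j₀ → RegionHyp (a + dsUp) j₁ → RegionHyp (a + dsUp + slotDown i) j₂ →
      DictThreeTerm (pencilBase (bOfA a)) (pencilApex (bOfA a) i) (fanCoeff (bOfA (a + dsUp)) i)
        a (a + dsUp) (a + dsUp + slotDown i) j₀ j₁ j₂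

/-- Shape sanity: the node is a restriction of gen-1's `DictPencil`. -/
theorem dictPencilZero_of_dictPencil (h : DictPencil) : DictPencilZero :=
  fun a i j₀ j₁ j₂ hi _ h₀ h₁ h₂ => h a i j₀ j₁ j₂ hi h₀ h₁ h₂

/-! ## 2. The pencil descent step at an arbitrary slot -/

/-- **PENCIL descent at slot `i`.** At a region point `a` with all slots `≥ 1`, the cellular pencil family, the
dictionary pencil relation AT THE ONE INSTANCE `(a − DS, i)`, and `explicitPQ` at `a − DS` and `a − s_i` give `explicitPQ`
at `a` (apex coefficient `b_i(N+1−b_i) ≠ 0`).  gen-1's `descent_pencil` is the case `i = 1` with the instance taken from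
`DictPencil`. -/
theorem descent_pencil_slot (hcP : CellPencil) {a : Fin 8 → ℤ} {j i : ℕ} (hi : i ∈ Icc 1 7) (hr : RegionHyp a j)
    (hpos : ∀ m ∈ Icc 1 7, 1 ≤ bOfA a m)
    (hdic : DictThreeTerm (pencilBase (bOfA (a - dsUp))) (pencilApex (bOfA (a - dsUp)) i)
      (fanCoeff (bOfA (a - dsUp + dsUp)) i) (a - dsUp) (a - dsUp + dsUp) (a - dsUp + dsUp + slotDown i) j j j)
    (h₀ : ExplicitPQAt (a - dsUp) j) (h₂ : ExplicitPQAt (a + slotDown i) j) : ExplicitPQAt a j := by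
  have hi' := hi
  simp only [mem_Icc] at hi'
  have hca : a - dsUp + dsUp = a := sub_add_cancel a dsUp
  have r₀ : RegionHyp (a - dsUp) j := regionHyp_sub_dsUp hr hpos
  have r₁ : RegionHyp (a - dsUp + dsUp) j := by rw [hca]; exact hr
  have r₂ : RegionHyp (a - dsUp + dsUp + slotDown i) j := by
    rw [hca]; exact regionHyp_slotDown hr hi (hpos i hi)
  have hrel := hcP (a - dsUp) i j j j hi r₀ r₁ r₂
  have hbi := hr.2.2.1 i hi
  have hpi := hpos i hi
  have hβ : ((pencilApex (bOfA (a - dsUp)) i : ℤ) : ℚ) ≠ 0 := by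
    have hne : pencilApex (bOfA (a - dsUp)) i ≠ 0 := by
      unfold pencilApex
      rw [bOfA_sub_dsUp a i hi'.2, bOfA_sub_dsUp a 0 (by norm_num), if_neg (by omega), if_pos rfl]
      exact mul_ne_zero (by omega) (by omega)
    exact_mod_cast hne
  have h := at_mid_of_threeTerm' hrel hdic h₀ (by rw [hca]; exact h₂) hβ
  rw [hca] at h
  exact h

/-! ## 3. The slot choice on the interior -/

/-- Two distinct slots at the top value `(N+1)/2` of a region point form a NON-edge pair, and the non-edge graph
`{16,17,27,35,45,46}` has no triangle: so for a slot `i` of maximal value, every non-edge pair avoiding `i` has sum `≤ N`. -/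
theorem nonEpair_sum_le_of_max {a : Fin 8 → ℤ} {j i : ℕ} (hr : RegionHyp a j) (hi : i ∈ Icc 1 7)
    (hmax : ∀ m ∈ Icc 1 7, bOfA a m ≤ bOfA a i) :
    ∀ jk ∈ nonEpairs, jk.1 ≠ i → jk.2 ≠ i → bOfA a jk.1 + bOfA a jk.2 ≤ bOfA a 0 := by
  obtain ⟨-, hconv, hbox, -, -⟩ := hr
  have hF := forms_of_converges hconv
  have hb1 := hbox 1 (by simp)
  have hb2 := hbox 2 (by simp)
  have hb3 := hbox 3 (by simp)
  have hb4 := hbox 4 (by simp)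
  have hb5 := hbox 5 (by simp)
  have hb6 := hbox 6 (by simp)
  have hb7 := hbox 7 (by simp)
  have hm1 := hmax 1 (by simp)
  have hm2 := hmax 2 (by simp)
  have hm3 := hmax 3 (by simp)
  have hm4 := hmax 4 (by simp)
  have hm5 := hmax 5 (by simp)
  have hm6 := hmax 6 (by simp)
  have hm7 := hmax 7 (by simp)
  have hi' := hi
  simp only [mem_Icc] at hi'
  obtain ⟨hi1, hi7⟩ := hi'
  intro jk hjk h1 h2
  simp only [nonEpairs, List.mem_cons, List.not_mem_nil, or_false] at hjk
  rcases hjk with rfl | rfl | rfl | rfl | rfl | rfl <;> simp only at h1 h2 ⊢ <;> interval_cases i <;>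
    simp only [bOfA] at hb1 hb2 hb3 hb4 hb5 hb6 hb7 hm1 hm2 hm3 hm4 hm5 hm6 hm7 ⊢ <;> omega

/-- **The interior slot.** At a region point with all slots `≥ 2` there is a slot `i` with `b_i ≥ 2`, `b_i + 2 ≤ N` and
every non-edge pair avoiding `i` of sum `≤ N` — i.e. the base `a − DS` and the slot `i` satisfy the side conditions of
`dictPencil_at`.  (Any slot of maximal value works.) -/
theorem exists_interior_slot {a : Fin 8 → ℤ} {j : ℕ} (hr : RegionHyp a j) (h2 : ∀ m ∈ Icc 1 7, 2 ≤ bOfA a m) :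
    ∃ i ∈ Icc 1 7, 2 ≤ bOfA a i ∧ bOfA a i + 2 ≤ bOfA a 0 ∧
      ∀ jk ∈ nonEpairs, jk.1 ≠ i → jk.2 ≠ i → bOfA a jk.1 + bOfA a jk.2 ≤ bOfA a 0 := by
  obtain ⟨i, hi, hmax⟩ := exists_max_image (Icc 1 7) (bOfA a) ⟨1, by simp⟩
  refine ⟨i, hi, h2 i hi, ?_, nonEpair_sum_le_of_max hr hi hmax⟩
  obtain ⟨-, hconv, hbox, hd, -⟩ := hr
  have hF := forms_of_converges hconv
  have hbi := hbox i hi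
  have h21 := h2 1 (by simp)
  have h22 := h2 2 (by simp)
  have h23 := h2 3 (by simp)
  have h24 := h2 4 (by simp)
  have h25 := h2 5 (by simp)
  have h26 := h2 6 (by simp)
  have h27 := h2 7 (by simp)
  rw [dOf_bOfA] at hd
  have hi' := hi
  simp only [mem_Icc] at hi'
  obtain ⟨hi1, hi7⟩ := hi'
  simp only [bOfA] at h21 h22 h23 h24 h25 h26 h27
  interval_cases i <;> simp only [bOfA] at hbi ⊢ <;> omega

/-- **The dictionary pencil instance for the descent**, from the interior theorem `dictPencil_at` (all slots `≥ 2`) or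
from the node `DictPencilZero` (a slot equal to `1`). -/
theorem pencil_instance (hdP0 : DictPencilZero) {a : Fin 8 → ℤ} {j : ℕ} (hr : RegionHyp a j)
    (hpos : ∀ m ∈ Icc 1 7, 1 ≤ bOfA a m) :
    ∃ i ∈ Icc 1 7, DictThreeTerm (pencilBase (bOfA (a - dsUp))) (pencilApex (bOfA (a - dsUp)) i)
      (fanCoeff (bOfA (a - dsUp + dsUp)) i) (a - dsUp) (a - dsUp + dsUp) (a - dsUp + dsUp + slotDown i) j j j := by
  have hca : a - dsUp + dsUp = a := sub_add_cancel a dsUp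
  have r₀ : RegionHyp (a - dsUp) j := regionHyp_sub_dsUp hr hpos
  have r₁ : RegionHyp (a - dsUp + dsUp) j := by rw [hca]; exact hr
  by_cases hone : ∃ m ∈ Icc 1 7, bOfA a m = 1
  · obtain ⟨m, hm, hm1⟩ := hone
    have hm7 : m ≤ 7 := (mem_Icc.1 hm).2
    have hm0 : m ≠ 0 := by have := (mem_Icc.1 hm).1; omega
    have r₂ : RegionHyp (a - dsUp + dsUp + slotDown m) j := by
      rw [hca]; exact regionHyp_slotDown hr hm (hpos m hm)
    refine ⟨m, hm, hdP0 (a - dsUp) m j j j hm ?_ r₀ r₁ r₂⟩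
    rw [bOfA_sub_dsUp a m hm7, if_neg hm0, hm1]; norm_num
  · push Not at hone
    have h2 : ∀ m ∈ Icc 1 7, 2 ≤ bOfA a m := fun m hm => by
      have := hpos m hm
      have := hone m hm
      omega
    obtain ⟨i, hi, hi2, hiN, hNE⟩ := exists_interior_slot hr h2
    have hi7 : i ≤ 7 := (mem_Icc.1 hi).2
    have hi0 : i ≠ 0 := by have := (mem_Icc.1 hi).1; omega
    have r₂ : RegionHyp (a - dsUp + dsUp + slotDown i) j := by
      rw [hca]; exact regionHyp_slotDown hr hi (hpos i hi)
    refine ⟨i, hi, dictPencil_at (a - dsUp) i j j j hi r₀ r₁ r₂ ?_ ?_ ?_⟩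
    · rw [bOfA_sub_dsUp a i hi7, if_neg hi0]; omega
    · rw [bOfA_sub_dsUp a i hi7, if_neg hi0, bOfA_sub_dsUp a 0 (by norm_num), if_pos rfl]; omega
    · intro jk hjk h1 h2
      have hle := hNE jk hjk h1 h2
      have hjk' : jk.1 ≤ 7 ∧ jk.2 ≤ 7 ∧ jk.1 ≠ 0 ∧ jk.2 ≠ 0 := by
        simp only [nonEpairs, List.mem_cons, List.not_mem_nil, or_false] at hjk
        rcases hjk with rfl | rfl | rfl | rfl | rfl | rfl <;> simp
      rw [bOfA_sub_dsUp a jk.1 hjk'.1, if_neg hjk'.2.2.1, bOfA_sub_dsUp a jk.2 hjk'.2.1, if_neg hjk'.2.2.2,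
        bOfA_sub_dsUp a 0 (by norm_num), if_pos rfl]
      omega

/-! ## 4. The descent with `DictPencilZero` in place of `DictPencil` -/

/-- **Level descent (re-routed).** gen-1's `explicitPQAt_level_of_terminal` with `DictPencil` replaced by
`DictPencilZero`: the pencil step runs at the slot of `pencil_instance`. -/
theorem explicitPQAt_level_of_terminal_zero (hcS : CellStar) (hdS : DictStar) (hcP : CellPencil)
    (hdP0 : DictPencilZero) {N : ℤ}
    (hlow : ∀ (c : Fin 8 → ℤ) (j : ℕ), bOfA c 0 = N - 2 → RegionHyp c j → ExplicitPQAt c j)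
    (hterm : ∀ (a : Fin 8 → ℤ) (j : ℕ), bOfA a 0 = N → Terminal a → RegionHyp a j → ExplicitPQAt a j) :
    ∀ (a : Fin 8 → ℤ) (j : ℕ), bOfA a 0 = N → RegionHyp a j → ExplicitPQAt a j := by
  suffices H : ∀ s : ℕ, ∀ (a : Fin 8 → ℤ) (j : ℕ), bOfA a 0 = N → RegionHyp a j → (slotSum a).toNat = s →
      ExplicitPQAt a j from fun a j hN hr => H _ a j hN hr rfl
  intro s
  induction s using Nat.strong_induction_on with
  | _ s ih =>
    intro a j hN hr hs
    have hbox := hr.2.2.1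
    have hb1 := hbox 1 (by simp)
    have hb2 := hbox 2 (by simp)
    have hb3 := hbox 3 (by simp)
    have hb4 := hbox 4 (by simp)
    have hb5 := hbox 5 (by simp)
    have hb6 := hbox 6 (by simp)
    have hb7 := hbox 7 (by simp)
    have hss : 0 ≤ slotSum a := by
      simp only [slotSum]
      omega
    by_cases hpos : ∀ i ∈ Icc 1 7, 1 ≤ bOfA a i
    · -- PENCIL step at the slot of `pencil_instance`: base `a − DS` (level `N − 2`), third point `a − s_i`
      have h₀ : ExplicitPQAt (a - dsUp) j :=
        hlow (a - dsUp) j (by rw [bOfA_sub_dsUp a 0 (by norm_num), if_pos rfl, hN]) (regionHyp_sub_dsUp hr hpos)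
      obtain ⟨i, hi, hdic⟩ := pencil_instance hdP0 hr hpos
      have hi1 : 1 ≤ i := (mem_Icc.1 hi).1
      have hge : bOfA a i ≤ slotSum a := le_slotSum hr hi
      have hpi := hpos i hi
      have hlt : (slotSum (a + slotDown i)).toNat < s := by
        rw [slotSum_add_slotDown a hi]
        omega
      have hN' : bOfA (a + slotDown i) 0 = N := by
        rw [bOfA_add_slotDown a i hi 0 (by norm_num), if_neg (by omega)]
        exact hN
      have h₂ : ExplicitPQAt (a + slotDown i) j :=
        ih _ hlt (a + slotDown i) j hN' (regionHyp_slotDown hr hi hpi) rfl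
      exact descent_pencil_slot hcP hi hr hpos hdic h₀ h₂
    · push Not at hpos
      obtain ⟨i₀, hi₀, hz⟩ := hpos
      by_cases hdis : ∃ p ∈ Icc 1 7, ∃ q ∈ Icc 1 7, bOfA a p ≠ 0 ∧ bOfA a q ≠ 0 ∧ bOfA a p ≠ bOfA a q
      · -- STAR step (verbatim from gen-1): both other members have smaller slot sum
        obtain ⟨p, hp, q, hq, hp0, hq0, hpq⟩ := hdis
        have hp1 : 1 ≤ bOfA a p := by
          have := hbox p hp
          omega
        have hq1 : 1 ≤ bOfA a q := by
          have := hbox q hq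
          omega
        have hp' : 1 ≤ p := (mem_Icc.1 hp).1
        have hq' : 1 ≤ q := (mem_Icc.1 hq).1
        have hNq : bOfA (a + slotDown q) 0 = N := by
          rw [bOfA_add_slotDown a q hq 0 (by norm_num), if_neg (show (0 : ℕ) ≠ q by omega)]
          exact hN
        have hNp : bOfA (a + slotDown p) 0 = N := by
          rw [bOfA_add_slotDown a p hp 0 (by norm_num), if_neg (show (0 : ℕ) ≠ p by omega)]
          exact hN
        have hgeq : bOfA a q ≤ slotSum a := le_slotSum hr hq
        have hltq : (slotSum (a + slotDown q)).toNat < s := by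
          rw [slotSum_add_slotDown a hq]
          omega
        have hltp : (slotSum (a + slotDown p)).toNat < s := by
          rw [slotSum_add_slotDown a hp]
          have hgep : bOfA a p ≤ slotSum a := le_slotSum hr hp
          omega
        have h₁ : ExplicitPQAt (a + slotDown q) j :=
          ih _ hltq (a + slotDown q) j hNq (regionHyp_slotDown hr hq hq1) rfl
        have h₂ : ExplicitPQAt (a + slotDown p) j :=
          ih _ hltp (a + slotDown p) j hNp (regionHyp_slotDown hr hp hp1) rfl
        exact descent_star hcS hdS hr hp hq hp1 hq1 hpq h₁ h₂
      · -- terminal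
        have hT : Terminal a := by
          refine ⟨⟨i₀, hi₀, ?_⟩, ?_⟩
          · have := hbox i₀ hi₀
            omega
          · intro p hp q hq hp0 hq0
            by_contra hne
            exact hdis ⟨p, hp, q, hq, hp0, hq0, hne⟩
        exact hterm a j hN hT hr

/-- **THE DESCENT THEOREM WITHOUT THE GLOBAL `DictPencil` (PROVED).**  Under `CellStar`, `DictStar`, `CellPencil` and
the thin node `DictPencilZero` (the dictionary pencil relation on the stratum `c_i = 0` only), `explicitPQ` holds as soon
as it holds at every terminal region point (same interface as gen-1's `explicitPQ_of_terminal`).  The interior of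
`DictPencil` is supplied by the tree's `dictPencil_at` (E-L19). -/
theorem explicitPQ_of_terminal_zero (hcS : CellStar) (hdS : DictStar) (hcP : CellPencil) (hdP0 : DictPencilZero)
    (hterm : ∀ (a : Fin 8 → ℤ) (j : ℕ), Terminal a → RegionHyp a j →
      (∀ (c : Fin 8 → ℤ) (j' : ℕ), bOfA c 0 < bOfA a 0 → RegionHyp c j' → ExplicitPQAt c j') → ExplicitPQAt a j) :
    explicitPQ := by
  rw [explicitPQ_iff_at]
  suffices H : ∀ n : ℕ, ∀ (a : Fin 8 → ℤ) (j : ℕ), (bOfA a 0).toNat = n → RegionHyp a j → ExplicitPQAt a j from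
    fun a j hr => H _ a j rfl hr
  intro n
  induction n using Nat.strong_induction_on with
  | _ n ih =>
    intro a j hn hr
    have hN0 : 0 ≤ bOfA a 0 := level_nonneg hr
    refine explicitPQAt_level_of_terminal_zero hcS hdS hcP hdP0 (N := bOfA a 0) ?_ ?_ a j rfl hr
    · intro c j' hc hr'
      have hc0 : 0 ≤ bOfA c 0 := level_nonneg hr'
      have hlt : (bOfA c 0).toNat < n := by
        rw [← hn]
        omega
      exact ih _ hlt c j' rfl hr'
    · intro a' j' ha' hT hr'
      refine hterm a' j' hT hr' ?_
      intro c j'' hlt' hrc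
      have hc0 : 0 ≤ bOfA c 0 := level_nonneg hrc
      exact ih _ (by omega) c j'' rfl hrc

/-- Shape sanity: gen-1's descent theorem is recovered (its hypothesis `DictPencil` implies `DictPencilZero`). -/
theorem explicitPQ_of_terminal_again (hcS : CellStar) (hdS : DictStar) (hcP : CellPencil) (hdP : DictPencil)
    (hterm : ∀ (a : Fin 8 → ℤ) (j : ℕ), Terminal a → RegionHyp a j →
      (∀ (c : Fin 8 → ℤ) (j' : ℕ), bOfA c 0 < bOfA a 0 → RegionHyp c j' → ExplicitPQAt c j') → ExplicitPQAt a j) :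
    explicitPQ :=
  explicitPQ_of_terminal_zero hcS hdS hcP (dictPencilZero_of_dictPencil hdP) hterm

end Summit.KontsevichZagierPeriods.Zeta5Search.Elimination
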